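import Literature.MathematicalPhysics.QuantumChemistry.EnergyFunctional
import Literature.MathematicalPhysics.QuantumChemistry.RDMLinearConditions
import Literature.MathematicalPhysics.QuantumChemistry.RDMSpinSectorConditions
import HarnessLib

/-!
# The variational 2-RDM ("DQG") relaxation is a lower bound to the ground-state energy

Topic `Literature/MathematicalPhysics/QuantumChemistry`; assembles `EnergyFunctional.lean` (the energy
is a linear functional of `(¹D, ²D)`), `PositivityConditions.lean` (the `D`, `Q`, `G` cones),
`RDMLinearConditions.lean` (trace / contraction / antisymmetry / Hermiticity) and
`RDMSpinSectorConditions.lean` (the `S_z`-sector rows) into the PRIMAL statement of the variational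
two-electron reduced-density-matrix method as printed in D. A. Mazziotti, *Variational two-electron
reduced-density-matrix theory* (Reduced-Density-Matrix Mechanics, Adv. Chem. Phys. 134, Wiley 2007)
Ch. 3 §II.A–B and M. Nakata et al., J. Chem. Phys. 128 (2008) 164113, §II.C:

  "the energy … is minimised as a functional of the 2-RDM … restricted by necessary
  `N`-representability conditions (the 2-positivity conditions `D, Q, G ⪰ 0`)"; since every
  `N`-representable pair satisfies them, the minimum is a LOWER BOUND to the exact (full-CI)
  ground-state energy: `E_PQG ≤ E_PQGT1 ≤ E_PQGT1T2 ≤ E_PQGT1T2′ ≤ E_fullCI` (Nakata et al. §II.C).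

Vendored here in the finite-dimensional, exact form the certified-quantum-chemistry cell uses:

* `qMap γ Γ`, `gMap γ Γ` — Mazziotti's linear interconversion maps eq. (14) (`²Q` from `(¹D, ²D)`,
  wedge products written out) and eq. (15) (`²G^{ij}_{kl} = δ_{jl} ¹D^i_k − ²D^{il}_{kj}`) as functions of
  an ABSTRACT pair `(γ, Γ)` at unit normalisation; on the reduced density matrices of a unit vector
  they return `twoHoleRDM ψ` and `particleHoleRDM ψ` (`qMap_rdm`, `gMap_rdm`, from
  `twoHoleRDM_apply` / `particleHoleRDM_apply`);
* `IsDQGFeasible N γ Γ` — the FEASIBLE SET of the DQG programme for `N` electrons: `Γ ⪰ 0`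
  (D-condition, eq. (11)), `qMap γ Γ ⪰ 0` (Q, eq. (12)), `gMap γ Γ ⪰ 0` (G, eq. (13)), Hermiticity,
  trace `Tr γ = N` and contraction `Σ_j Γ^{ij}_{kj} = (N−1) γ^i_k` (eq. (16)), antisymmetry of `Γ`;
  `IsDQGFeasible.of_state`: the pair `(oneRDM ψ, twoRDM ψ)` of every unit `N`-particle vector is
  feasible (the conditions are NECESSARY — §II.B);
* `rdmEnergy h g h_nuc γ Γ` — the energy functional `E = Tr(¹K ¹D) + Tr(²K ²D)` (eqs. (4)–(7)) of the
  spin-free molecular Hamiltonian written on an abstract pair; `rdmEnergy_rdm`: on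
  `(oneRDM ψ, twoRDM ψ)` it is `⟨ψ|Ĥ|ψ⟩` (`expect_molecularHamiltonian_eq_rdm`);
* **`le_groundEnergy_of_forall_isDQGFeasible`** — THE RELAXATION BOUND: any number `c` that lies
  below the functional on the whole feasible set (in particular the programme's optimal value, and a
  fortiori any rigorously certified lower bound of that value) satisfies `c ≤ E₀(Ĥ; N)`, the exact
  `N`-electron ground-state energy in the given spin-orbital basis;
* the `S_z`-SECTOR version used when the programme carries the sector rows of §II.F
  (`IsDQGFeasibleSector a b`, `IsDQGFeasibleSector.of_state`,
  **`le_sectorGroundEnergy_of_forall_isDQGFeasibleSector`**: `c ≤ E₀(Ĥ; N_α = a, N_β = b)`).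

Adding further necessary conditions (`T1`, `T2`, `T2′` of `ThreeIndexConditionsTwoRDM.lean` /
`ThreeIndexConditionsT2Prime.lean`) only shrinks the feasible set, so the same two theorems cover
every rung of the hierarchy: a bound valid on the DQG-feasible set is valid on any smaller set.
Everything is PROVED (0 sorry); the four definitions carry no analytic content beyond the printed
formulas; no named facts. What is NOT here: existence / attainment of the SDP optimum, strong duality,
and any statement about HOW CLOSE the relaxation is (tightness is empirical, Nakata et al. Tables).

## References
* D. A. Mazziotti, *Variational two-electron reduced-density-matrix theory*, in: D. A. Mazziotti
  (ed.), Reduced-Density-Matrix Mechanics, Adv. Chem. Phys. 134 (Wiley, 2007) 21–59, §II.A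
  eqs. (4)–(7) (energy functional), §II.B eqs. (11)–(17) (2-positivity, interconversion maps,
  contraction), §II.F (spin blocks). [cite: Mazziotti2007RDMChapter, §II.A-B eqs. (4)-(17)]
* M. Nakata, B. J. Braams, K. Fujisawa, M. Fukuda, J. K. Percus, M. Yamashita, Z. Zhao,
  J. Chem. Phys. 128 (2008) 164113, §II.C (`E_PQG ≤ … ≤ E_fullCI`: the SDP optimum is a lower bound).
  [cite: NakataEtAl2008, §II.C]
* C. Garrod, J. K. Percus, J. Math. Phys. 5 (1964) 1756, §IV (reduction of the `N`-particle
  variational problem to conditions on the 2-matrix). [cite: GarrodPercus1964, §IV]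
-/

noncomputable section

namespace Literature.MathematicalPhysics.QuantumChemistry

open Matrix Finset Literature.MathematicalPhysics.QuantumLattice
open scoped ComplexOrder

/-! ### The interconversion maps on abstract pairs and the DQG-feasible set -/

section Abstract

variable {ι : Type*} [LinearOrder ι] [Fintype ι]

/-- Mazziotti's **`Q`-map** (2007, eq. (14), wedge products written out, unit normalisation): the
two-hole matrix determined by an abstract pair `(γ, Γ) = (¹D, ²D)`,
`Q^{ij}_{kl} = δ_{ik}δ_{jl} − δ_{il}δ_{jk} − δ_{jl} γ^k_i + δ_{jk} γ^l_i + δ_{il} γ^k_j − δ_{ik} γ^l_j + Γ^{kl}_{ij}`.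
[cite: Mazziotti2007RDMChapter, §II.B eq. (14)] -/
def qMap (γ : Matrix ι ι ℂ) (Γ : Matrix (ι × ι) (ι × ι) ℂ) : Matrix (ι × ι) (ι × ι) ℂ :=
  fun p q =>
    ((if p.1 = q.1 then (1 : ℂ) else 0) * (if p.2 = q.2 then (1 : ℂ) else 0) -
        (if p.1 = q.2 then (1 : ℂ) else 0) * (if p.2 = q.1 then (1 : ℂ) else 0)) -
      (if p.2 = q.2 then (1 : ℂ) else 0) * γ q.1 p.1 + (if p.2 = q.1 then (1 : ℂ) else 0) * γ q.2 p.1 +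
      (if p.1 = q.2 then (1 : ℂ) else 0) * γ q.1 p.2 - (if p.1 = q.1 then (1 : ℂ) else 0) * γ q.2 p.2 +
      Γ q p

/-- Mazziotti's **`G`-map** (2007, eq. (15)): the particle-hole matrix determined by `(γ, Γ)`,
`G^{ij}_{kl} = δ_{jl} γ^i_k − Γ^{il}_{kj}`. [cite: Mazziotti2007RDMChapter, §II.B eq. (15)] -/
def gMap (γ : Matrix ι ι ℂ) (Γ : Matrix (ι × ι) (ι × ι) ℂ) : Matrix (ι × ι) (ι × ι) ℂ :=
  fun p q => (if p.2 = q.2 then γ p.1 q.1 else 0) - Γ (p.1, q.2) (q.1, p.2)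

/-- On the reduced density matrices of a UNIT vector the `Q`-map returns the two-hole RDM `²Q`.
Mazziotti (2007) eq. (14). [cite: Mazziotti2007RDMChapter, §II.B eq. (14)] -/
theorem qMap_rdm {ψ : Fock ι} (hψ1 : star ψ ⬝ᵥ ψ = 1) :
    qMap (oneRDM ψ) (twoRDM ψ) = twoHoleRDM ψ := by
  ext p q
  obtain ⟨i, j⟩ := p
  obtain ⟨k, l⟩ := q
  rw [twoHoleRDM_apply, hψ1, mul_one]
  rfl

/-- On the reduced density matrices of any vector the `G`-map returns the particle-hole RDM `²G`.
Mazziotti (2007) eq. (15). [cite: Mazziotti2007RDMChapter, §II.B eq. (15)] -/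
theorem gMap_rdm (ψ : Fock ι) : gMap (oneRDM ψ) (twoRDM ψ) = particleHoleRDM ψ := by
  ext p q
  obtain ⟨i, j⟩ := p
  obtain ⟨k, l⟩ := q
  rw [particleHoleRDM_apply]
  rfl

/-- **The feasible set of the DQG (2-positivity) programme** for `N` electrons at unit normalisation:
an abstract Hermitian pair `(γ, Γ)` with `Γ ⪰ 0` (D), `qMap γ Γ ⪰ 0` (Q), `gMap γ Γ ⪰ 0` (G), the
trace and contraction rows `Tr γ = N`, `Σ_j Γ^{ij}_{kj} = (N − 1) γ^i_k`, and fermionic antisymmetry of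
`Γ` in each index pair. Mazziotti (2007) §II.B eqs. (11)–(17); Nakata et al. (2008) §II.
[cite: Mazziotti2007RDMChapter, §II.B eqs. (11)-(17)] -/
structure IsDQGFeasible (N : ℕ) (γ : Matrix ι ι ℂ) (Γ : Matrix (ι × ι) (ι × ι) ℂ) : Prop where
  /-- Hermiticity of the 1-matrix. [cite: Mazziotti2007RDMChapter, §II.B eqs. (11)-(17)] -/
  herm_one : γ.IsHermitian
  /-- the D-condition `Γ ⪰ 0` (includes Hermiticity of `Γ`). [cite: Mazziotti2007RDMChapter, §II.B eq. (11)] -/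
  d_psd : Γ.PosSemidef
  /-- the Q-condition. [cite: Mazziotti2007RDMChapter, §II.B eq. (12)] -/
  q_psd : (qMap γ Γ).PosSemidef
  /-- the G-condition. [cite: Mazziotti2007RDMChapter, §II.B eq. (13)] -/
  g_psd : (gMap γ Γ).PosSemidef
  /-- trace row `Tr γ = N`. [cite: Mazziotti2007RDMChapter, §II.D.1] -/
  trace_one : ∑ i, γ i i = N
  /-- contraction row (eq. (16), multiplied out). [cite: Mazziotti2007RDMChapter, §II.B eq. (16)] -/
  contract : ∀ i k, ∑ j, Γ (i, j) (k, j) = ((N : ℂ) - 1) * γ i k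
  /-- antisymmetry in the upper pair. [cite: Mazziotti2007RDMChapter, §II.D.1 (iii)] -/
  swap_fst : ∀ i j q, Γ (j, i) q = -Γ (i, j) q
  /-- antisymmetry in the lower pair. [cite: Mazziotti2007RDMChapter, §II.D.1 (iii)] -/
  swap_snd : ∀ p k l, Γ p (l, k) = -Γ p (k, l)

/-- **The DQG conditions are NECESSARY**: the reduced density matrices `(¹D, ²D)` of every unit
`N`-particle vector form a DQG-feasible pair ("for a p-RDM that is parameterized by a wavefunction
these restrictions are always satisfied"). Mazziotti (2007) §II.B. [cite: Mazziotti2007RDMChapter, §II.B eqs. (11)-(17)] -/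
theorem IsDQGFeasible.of_state {N : ℕ} {ψ : Fock ι} (hψN : IsNParticle N ψ)
    (hψ1 : star ψ ⬝ᵥ ψ = 1) : IsDQGFeasible N (oneRDM ψ) (twoRDM ψ) where
  herm_one := (oneRDM_posSemidef ψ).1
  d_psd := twoRDM_posSemidef ψ
  q_psd := by rw [qMap_rdm hψ1]; exact twoHoleRDM_posSemidef ψ
  g_psd := by rw [gMap_rdm]; exact particleHoleRDM_posSemidef ψ
  trace_one := by rw [oneRDM_trace hψN, hψ1, mul_one]
  contract := twoRDM_contract hψN
  swap_fst := twoRDM_swap_fst ψ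
  swap_snd := twoRDM_swap_snd ψ

end Abstract

/-! ### The energy functional on abstract pairs and the relaxation bound -/

section Molecular

variable {Λ : Type*} [LinearOrder Λ] [Fintype Λ]

/-- **The energy functional of the spin-free molecular Hamiltonian on an abstract pair** (unit
normalisation): `E(γ, Γ) = Σ_pq h_pq Σ_σ γ^{pσ}_{qσ} + ½ Σ_pqrs g_pqrs Σ_στ Γ^{pσ,rτ}_{qσ,sτ} + h_nuc`
— Mazziotti's `Tr(¹K ¹D) + Tr(²K ²D)` with the reduced Hamiltonian read off from the integral tables.
[cite: Mazziotti2007RDMChapter, §II.A eqs. (4)-(7)] -/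
def rdmEnergy (h : Λ → Λ → ℂ) (g : Λ → Λ → Λ → Λ → ℂ) (hnuc : ℂ) (γ : Matrix (Orb Λ) (Orb Λ) ℂ)
    (Γ : Matrix (Orb Λ × Orb Λ) (Orb Λ × Orb Λ) ℂ) : ℂ :=
  ∑ p : Λ, ∑ q : Λ, h p q * ∑ σ : Fin 2, γ (orb p σ) (orb q σ) +
    (1 / 2 : ℂ) * ∑ p : Λ, ∑ q : Λ, ∑ r : Λ, ∑ s : Λ,
      g p q r s * ∑ σ : Fin 2, ∑ τ : Fin 2, Γ (orb p σ, orb r τ) (orb q σ, orb s τ) +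
    hnuc

/-- On the reduced density matrices of a unit vector the functional is the energy expectation
`⟨ψ|Ĥ|ψ⟩`. Mazziotti (2007) eqs. (1)–(7). [cite: Mazziotti2007RDMChapter, §II.A eqs. (4)-(7)] -/
theorem rdmEnergy_rdm (h : Λ → Λ → ℂ) (g : Λ → Λ → Λ → Λ → ℂ) (hnuc : ℂ) {ψ : Fock (Orb Λ)}
    (hψ1 : star ψ ⬝ᵥ ψ = 1) :
    rdmEnergy h g hnuc (oneRDM ψ) (twoRDM ψ) = star ψ ⬝ᵥ molecularHamiltonian h g hnuc *ᵥ ψ := by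
  rw [expect_molecularHamiltonian_eq_rdm, hψ1, mul_one, rdmEnergy]

/-- **THE VARIATIONAL 2-RDM LOWER BOUND (`N`-electron form).** If a real number `c` lies below the
energy functional on every DQG-feasible pair for `N` electrons — in particular the optimal value of
the DQG semidefinite programme, or any certified lower bound of it — then `c ≤ E₀(Ĥ; N)`, the exact
ground-state energy of the `N`-electron sector of the spin-orbital basis (`N ≤ 2|Λ|` so that the
sector is non-empty). "Because the 2-positivity conditions are necessary, the variational 2-RDM
energy is a lower bound": Mazziotti (2007) §II.A–B; Nakata et al. (2008) §II.C
(`E_PQG ≤ … ≤ E_fullCI`). [cite: NakataEtAl2008, §II.C] -/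
theorem le_groundEnergy_of_forall_isDQGFeasible (h : Λ → Λ → ℂ) (g : Λ → Λ → Λ → Λ → ℂ)
    (hnuc : ℂ) {N : ℕ} (hN : N ≤ Fintype.card (Orb Λ)) {c : ℝ}
    (hc : ∀ γ Γ, IsDQGFeasible N γ Γ → c ≤ (rdmEnergy h g hnuc γ Γ).re) :
    c ≤ Literature.MathematicalPhysics.QuantumLattice.groundEnergy (molecularHamiltonian h g hnuc) N := by
  unfold Literature.MathematicalPhysics.QuantumLattice.groundEnergy
  refine le_csInf (ThermodynamicLimit.groundEnergySet_nonempty _ hN) ?_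
  rintro E ⟨ψ, hψN, hψ1, rfl⟩
  have hE := hc _ _ (IsDQGFeasible.of_state hψN hψ1)
  rwa [rdmEnergy_rdm h g hnuc hψ1] at hE

/-! ### The `S_z`-sector programme -/

/-- **The feasible set of the DQG programme WITH SECTOR ROWS** `(N_α, N_β) = (a, b)` (a calculation
"in which the basis functions are only eigenfunctions of `Ŝ_z`", Mazziotti (2007) §II.F): DQG
feasibility for `N = a + b` together with the `S_z` selection rule of `γ`, the spin-resolved traces
`Tr γ_αα = a`, `Tr γ_ββ = b` and the traces of the `αα`, `ββ`, `αβ` blocks of `Γ`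
(eqs. (89)–(90) and (87)+(88): `a(a−1)`, `b(b−1)`, `ab`). [cite: Mazziotti2007RDMChapter, §II.F eqs. (87)-(90)] -/
structure IsDQGFeasibleSector (a b : ℕ) (γ : Matrix (Orb Λ) (Orb Λ) ℂ)
    (Γ : Matrix (Orb Λ × Orb Λ) (Orb Λ × Orb Λ) ℂ) : Prop where
  /-- DQG feasibility at `N = a + b`. [cite: Mazziotti2007RDMChapter, §II.B eqs. (11)-(17)] -/
  dqg : IsDQGFeasible (a + b) γ Γ
  /-- `S_z` selection rule of the 1-matrix. [cite: Mazziotti2007RDMChapter, §II.F] -/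
  spin_sel : ∀ p q : Λ, ∀ σ τ : Fin 2, σ ≠ τ → γ (orb p σ) (orb q τ) = 0
  /-- `Tr γ_αα = N_α`. [cite: Mazziotti2007RDMChapter, §II.F] -/
  trace_up : ∑ x, γ (orb x 0) (orb x 0) = a
  /-- `Tr γ_ββ = N_β`. [cite: Mazziotti2007RDMChapter, §II.F] -/
  trace_down : ∑ x, γ (orb x 1) (orb x 1) = b
  /-- trace of the `αα` block of `Γ`. [cite: Mazziotti2007RDMChapter, §II.F eq. (89)] -/
  trace_upUp : ∑ x, ∑ y, Γ (orb x 0, orb y 0) (orb x 0, orb y 0) = (a : ℂ) * ((a : ℂ) - 1)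
  /-- trace of the `ββ` block of `Γ`. [cite: Mazziotti2007RDMChapter, §II.F eq. (90)] -/
  trace_downDown : ∑ x, ∑ y, Γ (orb x 1, orb y 1) (orb x 1, orb y 1) = (b : ℂ) * ((b : ℂ) - 1)
  /-- trace of the `αβ` block of `Γ`. [cite: Mazziotti2007RDMChapter, §II.F eqs. (87)-(88)] -/
  trace_upDown : ∑ x, ∑ y, Γ (orb x 0, orb y 1) (orb x 0, orb y 1) = (a : ℂ) * (b : ℂ)

/-- **The sector rows are NECESSARY too**: the reduced density matrices of every unit vector of the
sector `(N_α, N_β) = (a, b)` are sector-feasible. Mazziotti (2007) §II.F.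
[cite: Mazziotti2007RDMChapter, §II.F eqs. (87)-(90)] -/
theorem IsDQGFeasibleSector.of_state {a b : ℕ} {ψ : Fock (Orb Λ)} (hψ : IsInSector a b ψ)
    (hψ1 : star ψ ⬝ᵥ ψ = 1) : IsDQGFeasibleSector a b (oneRDM ψ) (twoRDM ψ) where
  dqg := IsDQGFeasible.of_state hψ.isNParticle hψ1
  spin_sel p q σ τ hστ := oneRDM_orb_eq_zero_of_ne hψ p q hστ
  trace_up := by rw [sum_oneRDM_up hψ, hψ1, mul_one]
  trace_down := by rw [sum_oneRDM_down hψ, hψ1, mul_one]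
  trace_upUp := by rw [sum_twoRDM_upUp hψ, hψ1, mul_one]
  trace_downDown := by rw [sum_twoRDM_downDown hψ, hψ1, mul_one]
  trace_upDown := by rw [sum_twoRDM_upDown hψ, hψ1, mul_one]

/-- **THE VARIATIONAL 2-RDM LOWER BOUND (sector form).** For Hermitian integral data and a
non-trivial sector `a, b ≤ |Λ|`: if `c` lies below the energy functional on every sector-feasible
pair, then `c ≤ E₀(Ĥ; N_α = a, N_β = b)` (`sectorGroundEnergy`), the quantity the
certified-quantum-chemistry rows bound. Mazziotti (2007) §II.B, §II.F; Nakata et al. (2008) §II.C.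
[cite: NakataEtAl2008, §II.C] -/
theorem le_sectorGroundEnergy_of_forall_isDQGFeasibleSector {h : Λ → Λ → ℂ}
    {g : Λ → Λ → Λ → Λ → ℂ} {hnuc : ℂ} (hH : (molecularHamiltonian h g hnuc).IsHermitian) {a b : ℕ}
    (ha : a ≤ Fintype.card Λ) (hb : b ≤ Fintype.card Λ) {c : ℝ}
    (hc : ∀ γ Γ, IsDQGFeasibleSector a b γ Γ → c ≤ (rdmEnergy h g hnuc γ Γ).re) :
    c ≤ sectorGroundEnergy (molecularHamiltonian h g hnuc) a b := by
  obtain ⟨ψ, hψ, hψ1, hHψ⟩ := exists_unit_eigen_sectorGroundEnergy hH ha hb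
  have hE := hc _ _ (IsDQGFeasibleSector.of_state hψ hψ1)
  rw [rdmEnergy_rdm h g hnuc hψ1, hHψ, dotProduct_smul, hψ1, smul_eq_mul, mul_one,
    Complex.ofReal_re] at hE
  exact hE

end Molecular

end Literature.MathematicalPhysics.QuantumChemistry

end
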